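import Summits.Ventures.PercRepro.S1CircuitProfile
import Summits.Ventures.PercRepro.SixFourFinal
import Summits.Ventures.PercRepro.SevenThreeQThree
import Summits.Ventures.PercRepro.PhiCredit

/-!
# PercRepro — THE 4-CIRCUIT-SUMMAND CONSUMER AT `(9, 4)` (p2, gen 28; SUBCLAIM-S1 §6.10 (xvii)(f))

**C-025 at `(9, 4)` holds on `M ⊕ N` whenever `M` is a finite coloop-free matroid of rank `6` and `N` is a
`4`-circuit** (`N.E` a circuit of `4` elements, rank `3`) — from tree theorems only. The exact factorisation
(`S1DisjointSumU` / `S1DisjointSumY`) and the circuit's profile (`S1CircuitProfile`) give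
`#U(M ⊕ N; 9, 4) ≤ N_M(6, 4) + 4 · N_M(6, 3)` and
`#Y(M ⊕ N; 9, 4) ≥ 15 f_M(4) + 16 f_M(5) + 11 f_M(6)`; the cells `(6, 4)` (`SixFour.rls_six_four_holds`,
`Φ = 6/5`) and `(6, 3)` (`SevenThree.c025_three_all`, `Φ = 3`) of `M` bound `N_M(6, 4) ≤ (5/6) f_M(5)` and
`N_M(6, 3) ≤ (f_M(4) + f_M(5))/3`, so `Φ(9, 4) · #U ≤ 11.2 f_M(4) + 18.2 f_M(5)`, and the double count
`2 f_M(5) ≤ 6 f_M(6)` (`S1RankProfileDoubleCount`, coloop-free) closes the gap: `2.2 f_M(5) ≤ 11 f_M(6)`.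
This is the first cell-level consequence of the disjoint-sum plan: every `(9, d)` core with a `4`-circuit
summand satisfies the `(9, 4)` body. Nothing else is claimed about any cell.

* `phiK_nine_four` — `Φ(9, 4) = 42/5`;
* `ySet_six_four_eq`, `ySet_six_three_eq`, `rankSet_disjoint` — the `Y`-sets of the two cells of `M`;
* `ncard_U_disjointSum_circuit_four_le`, `ncard_Y_disjointSum_circuit_four_ge` — the two sides of the body;
* **`c025_nine_four_disjointSum_circuit_four`** — the consumer.
Axioms: standard.
-/

open scoped Matroid

namespace PercRepro

namespace S1

open Set

variable {α : Type}

/-- `Φ(9, 4) = 42/5`. -/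
theorem phiK_nine_four : phiK 9 4 = 42 / 5 := by
  unfold phiK
  rw [show Finset.Ioo 4 9 = {5, 6, 7, 8} from by decide, show (9 : ℕ) + 4 = 13 from rfl]
  rw [Finset.sum_insert (by decide), Finset.sum_insert (by decide), Finset.sum_insert (by decide),
    Finset.sum_singleton]
  rw [show Nat.choose 13 5 = 1287 by decide, show Nat.choose 13 6 = 1716 by decide,
    show Nat.choose 13 7 = 1716 by decide, show Nat.choose 13 8 = 1287 by decide,
    show Nat.choose 13 9 = 715 by decide]
  norm_num

/-- Rank-level sets at different levels are disjoint. -/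
theorem rankSet_disjoint (M : Matroid α) {a b : ℕ} (hab : a ≠ b) : Disjoint (rankSet M a) (rankSet M b) := by
  rw [Set.disjoint_left]
  rintro A ⟨-, ha⟩ ⟨-, hb⟩
  apply hab
  have h := ha.symm.trans hb
  exact_mod_cast h

/-- The `Y`-set of the cell `(6, 4)` is the rank level `5`. -/
theorem ySet_six_four_eq (M : Matroid α) :
    {A : Set α | A ⊆ M.E ∧ ((4 : ℕ) : ℕ∞) < M.eRk A ∧ M.eRk A < ((6 : ℕ) : ℕ∞)} = rankSet M 5 := by
  ext A
  simp only [mem_setOf_eq, rankSet]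
  constructor
  · rintro ⟨hAE, h1, h2⟩
    refine ⟨hAE, ?_⟩
    obtain ⟨n, hn⟩ := ENat.ne_top_iff_exists.mp (ne_top_of_lt h2)
    rw [← hn] at h1 h2 ⊢
    have h1' : 4 < n := by exact_mod_cast h1
    have h2' : n < 6 := by exact_mod_cast h2
    have h3 : n = 5 := by omega
    rw [h3]
  · rintro ⟨hAE, hA⟩
    refine ⟨hAE, ?_⟩
    rw [hA]
    constructor
    · exact_mod_cast (show (4 : ℕ) < 5 by norm_num)
    · exact_mod_cast (show (5 : ℕ) < 6 by norm_num)

/-- The `Y`-set of the cell `(6, 3)` is the union of the rank levels `4` and `5`. -/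
theorem ySet_six_three_eq (M : Matroid α) :
    {A : Set α | A ⊆ M.E ∧ ((3 : ℕ) : ℕ∞) < M.eRk A ∧ M.eRk A < ((6 : ℕ) : ℕ∞)} =
      rankSet M 4 ∪ rankSet M 5 := by
  ext A
  simp only [mem_setOf_eq, rankSet, mem_union]
  constructor
  · rintro ⟨hAE, h1, h2⟩
    obtain ⟨n, hn⟩ := ENat.ne_top_iff_exists.mp (ne_top_of_lt h2)
    rw [← hn] at h1 h2 ⊢
    have h1' : 3 < n := by exact_mod_cast h1
    have h2' : n < 6 := by exact_mod_cast h2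
    rcases Nat.lt_or_ge n 5 with h5 | h5
    · left
      refine ⟨hAE, ?_⟩
      have h3 : n = 4 := by omega
      rw [h3]
    · right
      refine ⟨hAE, ?_⟩
      have h3 : n = 5 := by omega
      rw [h3]
  · rintro (⟨hAE, hA⟩ | ⟨hAE, hA⟩)
    · refine ⟨hAE, ?_⟩
      rw [hA]
      constructor
      · exact_mod_cast (show (3 : ℕ) < 4 by norm_num)
      · exact_mod_cast (show (4 : ℕ) < 6 by norm_num)
    · refine ⟨hAE, ?_⟩
      rw [hA]
      constructor
      · exact_mod_cast (show (3 : ℕ) < 5 by norm_num)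
      · exact_mod_cast (show (5 : ℕ) < 6 by norm_num)

/-- **The `U`-side**: `#U(M ⊕ N; 9, 4) ≤ N_M(6, 4) + 4 · N_M(6, 3)` for `M` of rank `6` and `N` a
`4`-circuit — only the slices `(a₁, b₁) = (6, 4), (6, 3)` of the convolution survive. -/
theorem ncard_U_disjointSum_circuit_four_le (M N : Matroid α) [M.Finite] [N.Finite] (h : Disjoint M.E N.E)
    (hM : M.eRank = 6) (hN : N.IsCircuit N.E) (hN4 : N.E.ncard = 4) :
    {A : Set α | A ⊆ (M.disjointSum N h).E ∧ (M.disjointSum N h).eRk A = ((9 : ℕ) : ℕ∞) ∧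
        (M.disjointSum N h).eRk ((M.disjointSum N h).E \ A) = ((4 : ℕ) : ℕ∞)}.ncard ≤
      (profileSet M 6 4).ncard + 4 * (profileSet M 6 3).ncard := by
  have hN4' : N.E.ncard = 3 + 1 := hN4
  have hN3 : N.eRank = ((3 : ℕ) : ℕ∞) := eRank_eq_of_isCircuit_ground hN hN4'
  have hM6 : M.eRank = ((6 : ℕ) : ℕ∞) := by exact_mod_cast hM
  rw [disjointSum_ncard_U_eq_finsum M N h 9 4, finsum_mem_coe_finset]
  rw [Finset.sum_eq_add_of_mem (6, 4) (6, 3) (by decide) (by decide) (by decide) ?_]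
  · dsimp only
    rw [show (9 : ℕ) - 6 = 3 from rfl, show (4 : ℕ) - 4 = 0 from rfl, show (4 : ℕ) - 3 = 1 from rfl]
    have h0 := ncard_profileSet_top_zero_le hN hN4' (by norm_num)
    have h1 := ncard_profileSet_top_one_le hN hN4'
    calc (profileSet M 6 4).ncard * (profileSet N 3 0).ncard +
          (profileSet M 6 3).ncard * (profileSet N 3 1).ncard
        ≤ (profileSet M 6 4).ncard * 1 + (profileSet M 6 3).ncard * (3 + 1) :=
          Nat.add_le_add (Nat.mul_le_mul_left _ h0) (Nat.mul_le_mul_left _ h1)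
      _ = (profileSet M 6 4).ncard + 4 * (profileSet M 6 3).ncard := by ring
  · rintro ⟨a, b⟩ hmem ⟨hne1, hne2⟩
    rw [Finset.mem_product, Finset.mem_range, Finset.mem_range] at hmem
    dsimp only
    rcases Nat.lt_or_ge 6 a with ha | ha
    · rw [profileSet_eq_empty_of_eRank_lt M hM6 ha b, ncard_empty, zero_mul]
    rcases Nat.lt_or_ge a 6 with ha' | ha'
    · rw [profileSet_eq_empty_of_eRank_lt N hN3 (by omega) (4 - b), ncard_empty, mul_zero]
    have ha6 : a = 6 := by omega
    subst ha6
    have hb : b ≤ 2 := by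
      rcases Nat.lt_or_ge b 3 with hb | hb
      · omega
      · exfalso
        rcases Nat.lt_or_ge b 4 with hb4 | hb4
        · exact hne2 (by congr 1; omega)
        · exact hne1 (by congr 1; omega)
    rw [show (9 : ℕ) - 6 = 3 from rfl, profileSet_top_eq_empty_of_two_le hN hN4' (by omega), ncard_empty,
      mul_zero]

/-- **The `Y`-side**: `#Y(M ⊕ N; 9, 4) ≥ 15 f_M(4) + 16 f_M(5) + 11 f_M(6)` for `N` a `4`-circuit — the ten
slices `(a₁, a₂)` with `a₁ ∈ {4, 5, 6}` of the convolution, with `f_N(0) ≥ 1`, `f_N(1) ≥ 4`, `f_N(2) ≥ 6`,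
`f_N(3) ≥ 5`. -/
theorem ncard_Y_disjointSum_circuit_four_ge (M N : Matroid α) [M.Finite] [N.Finite] (h : Disjoint M.E N.E)
    (hN : N.IsCircuit N.E) (hN4 : N.E.ncard = 4) :
    15 * (rankSet M 4).ncard + 16 * (rankSet M 5).ncard + 11 * (rankSet M 6).ncard ≤
      {A : Set α | A ⊆ (M.disjointSum N h).E ∧ ((4 : ℕ) : ℕ∞) < (M.disjointSum N h).eRk A ∧
        (M.disjointSum N h).eRk A < ((9 : ℕ) : ℕ∞)}.ncard := by
  have hN4' : N.E.ncard = 3 + 1 := hN4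
  rw [disjointSum_ncard_Y_eq_finsum M N h 9 4, finsum_mem_coe_finset]
  have hsub : ({(4, 1), (4, 2), (4, 3), (5, 0), (5, 1), (5, 2), (5, 3), (6, 0), (6, 1), (6, 2)} :
      Finset (ℕ × ℕ)) ⊆
      (Finset.range 9 ×ˢ Finset.range 9).filter (fun x : ℕ × ℕ => 4 < x.1 + x.2 ∧ x.1 + x.2 < 9) := by
    decide
  refine le_trans ?_ (Finset.sum_le_sum_of_subset hsub)
  rw [Finset.sum_insert (by decide), Finset.sum_insert (by decide), Finset.sum_insert (by decide),
    Finset.sum_insert (by decide), Finset.sum_insert (by decide), Finset.sum_insert (by decide),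
    Finset.sum_insert (by decide), Finset.sum_insert (by decide), Finset.sum_insert (by decide),
    Finset.sum_singleton]
  dsimp only
  have f0 : 1 ≤ (rankSet N 0).ncard := by
    have := choose_le_ncard_rankSet_of_isCircuit_ground hN hN4' (a := 0) (by norm_num)
    rwa [Nat.choose_zero_right] at this
  have f1 : 4 ≤ (rankSet N 1).ncard := by
    have := choose_le_ncard_rankSet_of_isCircuit_ground hN hN4' (a := 1) (by norm_num)
    rwa [Nat.choose_one_right] at this
  have f2 : 6 ≤ (rankSet N 2).ncard := by
    have := choose_le_ncard_rankSet_of_isCircuit_ground hN hN4' (a := 2) (by norm_num)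
    rwa [show Nat.choose (3 + 1) 2 = 6 by decide] at this
  have f3 : 5 ≤ (rankSet N 3).ncard := ncard_rankSet_top_of_isCircuit_ground hN hN4'
  have e41 := Nat.mul_le_mul_left (rankSet M 4).ncard f1
  have e42 := Nat.mul_le_mul_left (rankSet M 4).ncard f2
  have e43 := Nat.mul_le_mul_left (rankSet M 4).ncard f3
  have e50 := Nat.mul_le_mul_left (rankSet M 5).ncard f0
  have e51 := Nat.mul_le_mul_left (rankSet M 5).ncard f1
  have e52 := Nat.mul_le_mul_left (rankSet M 5).ncard f2
  have e53 := Nat.mul_le_mul_left (rankSet M 5).ncard f3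
  have e60 := Nat.mul_le_mul_left (rankSet M 6).ncard f0
  have e61 := Nat.mul_le_mul_left (rankSet M 6).ncard f1
  have e62 := Nat.mul_le_mul_left (rankSet M 6).ncard f2
  linarith

/-- The arithmetic of the consumer, abstracted: `u ≤ P₄ + 4 P₃`, `y ≥ 15 f₄ + 16 f₅ + 11 f₆`,
`(6/5) P₄ ≤ f₅`, `3 P₃ ≤ f₄ + f₅`, `2 f₅ ≤ 6 f₆` give `(42/5) u ≤ y`. -/
theorem consumer_arith_circuit_four {u y P4 P3 f4 f5 f6 : ℚ} (hU : u ≤ P4 + 4 * P3)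
    (hY : 15 * f4 + 16 * f5 + 11 * f6 ≤ y) (h64 : 6 / 5 * P4 ≤ f5) (h63 : 3 * P3 ≤ f4 + f5)
    (hdc : 2 * f5 ≤ (5 + 1) * f6) (hf4 : 0 ≤ f4) (hf6 : 0 ≤ f6) : 42 / 5 * u ≤ y := by
  linarith

/-- **THE 4-CIRCUIT-SUMMAND CONSUMER**: `Φ(9, 4) · #U(M ⊕ N; 9, 4) ≤ #Y(M ⊕ N; 9, 4)` — the C-025 body at
`(9, 4)` — for every finite coloop-free `M` of rank `6` and every finite `N` whose ground set is a circuit of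
`4` elements. From the tree cells `(6, 4)` and `(6, 3)` of `M` and the double count. -/
theorem c025_nine_four_disjointSum_circuit_four (M N : Matroid α) [M.Finite] [N.Finite]
    (h : Disjoint M.E N.E) (hM : M.eRank = 6) (hcol : M.coloops = ∅) (hN : N.IsCircuit N.E)
    (hN4 : N.E.ncard = 4) :
    phiK 9 4 * ({A : Set α | A ⊆ (M.disjointSum N h).E ∧ (M.disjointSum N h).eRk A = ((9 : ℕ) : ℕ∞) ∧
        (M.disjointSum N h).eRk ((M.disjointSum N h).E \ A) = ((4 : ℕ) : ℕ∞)}.ncard : ℚ) ≤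
      ({A : Set α | A ⊆ (M.disjointSum N h).E ∧ ((4 : ℕ) : ℕ∞) < (M.disjointSum N h).eRk A ∧
        (M.disjointSum N h).eRk A < ((9 : ℕ) : ℕ∞)}.ncard : ℚ) := by
  have hU := ncard_U_disjointSum_circuit_four_le M N h hM hN hN4
  have hY := ncard_Y_disjointSum_circuit_four_ge M N h hN hN4
  have h64 : (6 / 5 : ℚ) * ((profileSet M 6 4).ncard : ℚ) ≤ ((rankSet M 5).ncard : ℚ) := by
    have h0 := SixFour.rls_six_four_holds M
    unfold ThmN.RLS at h0
    rw [phiK_six_four, ySet_six_four_eq] at h0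
    exact h0
  have h63 : (3 : ℚ) * ((profileSet M 6 3).ncard : ℚ) ≤
      ((rankSet M 4).ncard : ℚ) + ((rankSet M 5).ncard : ℚ) := by
    have h0 := SevenThree.c025_three_all M 6 (by norm_num)
    unfold ThmN.RLS at h0
    rw [phiK_six_three, ySet_six_three_eq,
      ncard_union_eq (rankSet_disjoint M (by norm_num)) (rankSet_finite M 4) (rankSet_finite M 5)] at h0
    push_cast at h0
    exact h0
  have hM' : M.eRank = ((5 + 1 : ℕ) : ℕ∞) := by rw [hM]; norm_num
  have hdc := two_mul_ncard_rankSet_le M hM' hcol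
  rw [phiK_nine_four]
  have hU' : (({A : Set α | A ⊆ (M.disjointSum N h).E ∧ (M.disjointSum N h).eRk A = ((9 : ℕ) : ℕ∞) ∧
      (M.disjointSum N h).eRk ((M.disjointSum N h).E \ A) = ((4 : ℕ) : ℕ∞)}.ncard : ℕ) : ℚ) ≤
      ((profileSet M 6 4).ncard : ℚ) + 4 * ((profileSet M 6 3).ncard : ℚ) := by
    exact_mod_cast hU
  have hY' : 15 * ((rankSet M 4).ncard : ℚ) + 16 * ((rankSet M 5).ncard : ℚ) +
      11 * ((rankSet M 6).ncard : ℚ) ≤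
      (({A : Set α | A ⊆ (M.disjointSum N h).E ∧ ((4 : ℕ) : ℕ∞) < (M.disjointSum N h).eRk A ∧
        (M.disjointSum N h).eRk A < ((9 : ℕ) : ℕ∞)}.ncard : ℕ) : ℚ) := by
    exact_mod_cast hY
  have hdc' : 2 * ((rankSet M 5).ncard : ℚ) ≤ (5 + 1) * ((rankSet M 6).ncard : ℚ) := by
    exact_mod_cast hdc
  have hf4 : (0 : ℚ) ≤ ((rankSet M 4).ncard : ℚ) := Nat.cast_nonneg _
  have hf6 : (0 : ℚ) ≤ ((rankSet M 6).ncard : ℚ) := Nat.cast_nonneg _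
  exact consumer_arith_circuit_four hU' hY' h64 h63 hdc' hf4 hf6

end S1

end PercRepro
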